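import Literature.Geometry.Kaehler.ComplexTorusAnalyticIteratedIntersectionPositivity
import HarnessLib

/-!
# Proper points lie on the Fulton cycle: for an arbitrary iterated intersection `Y ∩ ⋂_j (D_j − τ_j)` the
# effective cycle representing `sign(e)^k · [Y] ∧ [D₀] ∧ ⋯ ∧ [D_{k−1}]` contains every point at which the
# intersection has the expected dimension

Layer `Literature/Geometry/Kaehler`; lane `lit-hodgefound`, seat p07, programme «INTERSECTION NUMBERS ARE
POINT COUNTS», file 18. Let `X = E/Λ` be a compact complex torus, `Y ⊆ X` closed analytic of pure dimension
`d = r + 1 + k`, `D₀, …, D_{k−1}` closed analytic hypersurfaces, `τ ∈ X^k` ARBITRARY, `Z(τ) = Y ∩ ⋂_j (D_j − τ_j)`.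
File 10 (Fulton Thm. 12.2 (a)) represents the intersection class by an effective `(r+1)`-cycle `R` supported
on `Z(τ)`, obtained as a limit of the intersection cycles of generic neighbouring translates. This file
sharpens the construction: the support `|R|` is empty or of pure dimension `r + 1`, and

  every PROPER point of `Z(τ)` — a point near which `Z(τ)` has (local) dimension `≤ r + 1` — lies on `|R|`.

Indeed a proper point persists in the neighbouring translates (Remmert's open mapping theorem, the pointwise
persistence theorem `mem_closure_iUnion_inter_iInter_translate` of `ComplexTorusAnalyticIteratedTranslatesPersistence`),
hence lies in the limit set of their intersection cycles, which is `|R|`. This is the support-level content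
of Fulton's refined statement: in the canonical decomposition `V₁ ⋯ V_r = Σ_Z α_Z` over the distinguished
varieties, every irreducible component `Z` of the intersection is distinguished, `α_Z` is a POSITIVE multiple
of `[Z]` when `Z` is a proper component (Prop. 7.1 (a)), and all `α_Z ≥ 0` on a variety with generated
tangent bundle (Thm. 12.2 (a)); so the proper components survive in the total class even in the presence of
excess components. Consequences: a region where `Z(τ)` coincides with a pure `(r+1)`-dimensional analytic
set lies in `|R|`; ONE proper point forces `[Y] ∧ [D₀] ∧ ⋯ ∧ [D_{k−1}] ≠ 0` (file 8 §6 needed `Z(τ)` globally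
proper). The expected-dimension-`0` counterpart (isolated points, counted) is file 17.

> [Fulton1998, §7.1 Prop. 7.1 (a); §12.2 Thm. 12.2 (a): "the canonical decomposition … `α_Z ≥ 0`";
> §11.1 Cor. 11.1 (the limit cycle)]; [Chirka1989, §15.5 (limit sets, p. 202), §16.1 Prop. 1 (p. 206)].

Contents (theorems only; no definitions, no named facts):

* §1 **`exists_effectiveCycle_smul_wedge_wedgeFamily_eq_chainCycleClass_forall_mem_support`** — THE THEOREM
  (`|R| ⊆ Z(τ)`, `|R|` empty or pure `(r+1)`-dimensional, proper points of `Z(τ)` lie on `|R|`, `class = cl(R)`);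
* §2 `wedge_wedgeFamily_ne_zero_of_proper_point` — one proper point forces a non-zero class;
  `exists_effectiveCycle_inter_subset_support_of_inter_eq_inter` — a locally proper region `Z(τ) ∩ V = W ∩ V`
  (`W` pure `(r+1)`-dimensional, `V` open) lies on `|R|`; `wedge_wedgeFamily_ne_zero_of_inter_eq_inter`.

## References

* [Fulton1998] W. Fulton, *Intersection Theory*, 2nd ed., Springer 1998, §7.1 Prop. 7.1 (a), §11.1
  Cor. 11.1, Example 11.4.5, §12.2 Thm. 12.2 (a) and Example 12.2.1 (a).
* [Chirka1989] E. M. Chirka, *Complex Analytic Sets*, Kluwer 1989, §12.1 (p. 136–139), §15.5 (p. 202),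
  §16.1 Prop. 1 (p. 206).
* [Lange2023AbelianVarietiesComplex] H. Lange, *Abelian Varieties over the Complex Numbers*, Springer 2023,
  §4.6.2 p. 235 and §6.2.1.
-/

noncomputable section

open scoped Manifold Topology Pointwise
open MeasureTheory Set Function Filter Module
open Literature.LinearAlgebra.Alternating

namespace Literature.Geometry.Kaehler
namespace ComplexTorus

universe u

variable {ι : Type*} [Fintype ι] [DecidableEq ι] {E : Type u} [NormedAddCommGroup E] [InnerProductSpace ℂ E]
  [FiniteDimensional ℂ E] [MeasurableSpace E] [BorelSpace E] (Φ : (ι → ℝ) ≃L[ℝ] E) {n : ℕ} (e : Fin n ≃ ι)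

omit [Fintype ι] [DecidableEq ι] [FiniteDimensional ℂ E] [MeasurableSpace E] [BorelSpace E] in
/-- The sub-intersection over all indices is the iterated intersection. [folklore] -/
private theorem inter_biInter_translate_univ₁₈ {k : ℕ} (Y : Set (ComplexTorus Φ))
    (D : Fin k → Set (ComplexTorus Φ)) (τ : Fin k → ComplexTorus Φ) :
    Y ∩ ⋂ j ∈ (Finset.univ : Finset (Fin k)), (fun x ↦ x + τ j) ⁻¹' D j =
      Y ∩ ⋂ j, (fun x ↦ x + τ j) ⁻¹' D j := by
  simp only [Finset.mem_univ, iInter_true]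

/-! ### §1 The Fulton cycle contains every proper point -/

/-- **PROPER POINTS LIE ON THE FULTON CYCLE.** Let `Y ⊆ X` be closed analytic of pure dimension
`d = r + 1 + k`, `D₀, …, D_{k−1}` closed analytic hypersurfaces and `τ ∈ X^k` arbitrary. There is an EFFECTIVE
analytic `(r+1)`-cycle `R` with: `|R| ⊆ Z(τ) = Y ∩ ⋂_j (D_j − τ_j)`; `|R|` empty or of pure dimension `r + 1`;
every point `z ∈ Z(τ)` near which all regular points of `Z(τ)` have codimension `≥ g − (r + 1)` (a PROPER
point: `dim_z Z(τ) ≤ r + 1`) lies on `|R|`; and `sign(e)^k · [Y]_e ∧ [D₀]_e ∧ ⋯ ∧ [D_{k−1}]_e = cl(R)`. The cycle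
is the limit of the intersection cycles `[Z(σ_m)] + T_m` of generic `σ_m → τ` (file 4; cycle compactness,
`exists_subseq_effectiveCycle_of_degree_le`); its support is the limit set of the `Z(σ_m)`, which lies in
`Z(τ)` (closedness) and contains every proper point of `Z(τ)` (persistence,
`mem_closure_iUnion_inter_iInter_translate`). If instead some generic translate is empty, the class is `0`,
`R = 0`, and `Z(τ)` has no proper point at all (a proper point would persist into nearby generic, hence
proper non-empty, translates, whose class is non-zero). [cite: Fulton1998, §7.1 Prop. 7.1 (a), §11.1 Cor. 11.1 and §12.2 Thm. 12.2 (a)]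
[cite: Chirka1989, §15.5 (p. 202) and §16.1 Prop. 1 (p. 206)] [cite: Lange2023AbelianVarietiesComplex, §4.6.2 p. 235] -/
theorem exists_effectiveCycle_smul_wedge_wedgeFamily_eq_chainCycleClass_forall_mem_support {q : ℕ}
    (hq : 2 * q + 2 * 1 = n) (k : ℕ) {d p p' r : ℕ} (hk : 2 * d + 2 * p = n) (hp' : p + k = p')
    (hr : r + 1 + k = d) {Y : Set (ComplexTorus Φ)} (hY : HasPureDim 𝓘(ℂ, E) Y d)
    {D : Fin k → Set (ComplexTorus Φ)} (hD : ∀ j, HasPureDim 𝓘(ℂ, E) (D j) q) (τ : Fin k → ComplexTorus Φ) :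
    ∃ R : HolomorphicChain 𝓘(ℂ, E) (ComplexTorus Φ) (r + 1), (∀ W, 0 ≤ R.mult W) ∧
      R.support ⊆ Y ∩ ⋂ j, (fun x ↦ x + τ j) ⁻¹' D j ∧
      (R.support = ∅ ∨ HasPureDim 𝓘(ℂ, E) R.support (r + 1)) ∧
      (∀ z ∈ Y ∩ ⋂ j, (fun x ↦ x + τ j) ⁻¹' D j,
        (∀ᶠ x in 𝓝 z, x ∈ Y ∩ ⋂ j, (fun x ↦ x + τ j) ⁻¹' D j →
          ∀ q', IsRegularPointOfCodim 𝓘(ℂ, E) (Y ∩ ⋂ j, (fun x ↦ x + τ j) ⁻¹' D j) q' x →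
            finrank ℂ E ≤ q' + (r + 1)) → z ∈ R.support) ∧
        (orientationSign Φ e : ℂ) ^ k •
            ((analyticCycleClass Φ e hk hY).wedge
                (wedgeFamily k fun j ↦ analyticCycleClass Φ e hq (hD j))).domDomCongr
              (finCongr (by omega : 2 * p + 2 * k = 2 * p')) =
          chainCycleClass Φ e (by omega : 2 * (r + 1) + 2 * p' = n) R := by
  classical
  have hng : finrank ℂ E * 2 = n := finrank_complex_mul_two Φ e
  have hq1 : q + 1 = finrank ℂ E := by omega
  have hkd : k ≤ d := by omega
  have h2 : 2 * (r + 1) + 2 * p' = n := by omega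
  have hrk : (r + 1) + k * finrank ℂ E = d + ∑ _j : Fin k, q := by
    rw [Finset.sum_const, Finset.card_univ, Fintype.card_fin, smul_eq_mul]
    have : k * finrank ℂ E = k * q + k := by rw [← hq1]; ring
    omega
  set c := (orientationSign Φ e : ℂ) ^ k •
      ((analyticCycleClass Φ e hk hY).wedge
          (wedgeFamily k fun j ↦ analyticCycleClass Φ e hq (hD j))).domDomCongr
        (finCongr (by omega : 2 * p + 2 * k = 2 * p')) with hc
  obtain ⟨-, hdense, -⟩ := isOpen_dense_ae_forall_inter_biInter_translate_eq_empty_or_hasPureDim Φ hq1 hkd hY hD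
  -- if some generic translate is empty, the class vanishes, `R = 0`, and there is no proper point
  by_cases hempty : ∃ σ : Fin k → ComplexTorus Φ,
      (∀ s : Finset (Fin k), Y ∩ ⋂ j ∈ s, (fun x ↦ x + σ j) ⁻¹' D j = ∅ ∨
        HasPureDim 𝓘(ℂ, E) (Y ∩ ⋂ j ∈ s, (fun x ↦ x + σ j) ⁻¹' D j) (d - s.card)) ∧
      Y ∩ ⋂ j, (fun x ↦ x + σ j) ⁻¹' D j = ∅
  · obtain ⟨σ₀, hσ₀G, hσ₀0⟩ := hempty
    have hcl0 : (analyticCycleClass Φ e hk hY).wedge (wedgeFamily k fun j ↦ analyticCycleClass Φ e hq (hD j)) = 0 :=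
      wedge_wedgeFamily_eq_zero_of_proper_of_eq_empty Φ e hq k hk hkd hY hD σ₀ hσ₀G hσ₀0
    refine ⟨0, fun W ↦ le_rfl, by rw [HolomorphicChain.support_zero]; exact empty_subset _,
      Or.inl (HolomorphicChain.support_zero), fun z hz hdim ↦ ?_, ?_⟩
    · -- a proper point persists into nearby generic translates, whose class is then non-zero
      exfalso
      have hev := eventually_nonempty_inter_iInter_translate Φ hY hD hrk hz hdim univ_mem
      obtain ⟨V, hVsub, hVo, hτV⟩ := _root_.mem_nhds_iff.1 hev
      obtain ⟨σ, hσG, hσV⟩ := hdense.exists_mem_open hVo ⟨τ, hτV⟩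
      have hne : (Y ∩ ⋂ j, (fun x ↦ x + σ j) ⁻¹' D j).Nonempty := by
        have h : σ ∈ {x | (univ ∩ (Y ∩ ⋂ j, (fun y ↦ y + x j) ⁻¹' D j)).Nonempty} := hVsub hσV
        simpa only [mem_setOf_eq, univ_inter] using h
      have hσ := hσG Finset.univ
      rw [inter_biInter_translate_univ₁₈, Finset.card_univ, Fintype.card_fin, show d - k = r + 1 by omega] at hσ
      exact wedge_wedgeFamily_ne_zero_of_hasPureDim Φ e hq k hk (r := r + 1) (by omega) hY hD σ
        (hσ.resolve_left hne.ne_empty) hcl0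
    · rw [hc, hcl0, domDomCongr_finCongr_zero, smul_zero, chainCycleClass_zero]
  push Not at hempty
  -- generic `σ_m → τ`
  obtain ⟨σ, hσG, hσ0⟩ := mem_closure_iff_seq_limit.1 (hdense τ)
  have hZm : ∀ m, HasPureDim 𝓘(ℂ, E) (Y ∩ ⋂ j, (fun x ↦ x + σ m j) ⁻¹' D j) (r + 1) := by
    intro m
    have h := hσG m Finset.univ
    rw [inter_biInter_translate_univ₁₈, Finset.card_univ, Fintype.card_fin, show d - k = r + 1 by omega] at h
    exact h.resolve_left (hempty (σ m) (hσG m)).ne_empty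
  choose T hT0 hTs hTcl using fun m ↦
    exists_effectiveCycle_smul_wedge_wedgeFamily_eq_setCycleClass_add Φ e hq k hk hp' (r := r + 1) (by omega)
      hY hD (σ m) (hσG m)
  set Rm : ℕ → HolomorphicChain 𝓘(ℂ, E) (ComplexTorus Φ) (r + 1) :=
    fun m ↦ HolomorphicChain.ofSet _ (hZm m) + T m with hRdef
  have hR0 : ∀ m W, 0 ≤ (Rm m).mult W := fun m W ↦ by
    change 0 ≤ (HolomorphicChain.ofSet _ (hZm m) + T m).mult W
    rw [HolomorphicChain.mult_add, Pi.add_apply, HolomorphicChain.mult_ofSet]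
    split_ifs
    · exact add_nonneg zero_le_one (hT0 m W)
    · rw [zero_add]; exact hT0 m W
  have hRsupp : ∀ m, (Rm m).support = Y ∩ ⋂ j, (fun x ↦ x + σ m j) ⁻¹' D j := fun m ↦
    support_ofSet_add_eq_of_nonneg Φ (hZm m) (hT0 m) (hTs m)
  have hRcl : ∀ m, chainCycleClass Φ e h2 (Rm m) = c := by
    intro m
    rw [hc, hTcl m]
    change chainCycleClass Φ e h2 (HolomorphicChain.ofSet _ (hZm m) + T m) = _
    rw [chainCycleClass_add, chainCycleClass_ofSet, setCycleClass_of_hasPureDim Φ e _ (hZm m)]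
  have hdeg : ∀ m, (poincarePairing Φ e h2 (Complex.ofRealCLM.compContinuousAlternatingMap (kaehlerPow (r + 1)))
      (chainCycleClass Φ e h2 (Rm m))).re ≤
      (poincarePairing Φ e h2 (Complex.ofRealCLM.compContinuousAlternatingMap (kaehlerPow (r + 1))) c).re :=
    fun m ↦ by rw [hRcl m]
  obtain ⟨κ, S, hκ, hS0, hSpure, -, hlim, -, -, hScl⟩ := exists_subseq_effectiveCycle_of_degree_le Φ e h2 hR0 hdeg
  refine ⟨S, hS0, fun z hz ↦ ?_, hSpure, fun z hz hdim ↦ ?_, ?_⟩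
  · -- the limit set of `Z(σ_{κ m})` lies in `Z(τ)`
    have hz' := (hlim z).1 hz
    simp_rw [hRsupp] at hz'
    exact mem_inter_iInter_translate_of_forall_mem_closure_iUnion Φ hY.isAnalyticSet.isClosed
      (fun i ↦ (hD i).isAnalyticSet.isClosed) (hσ0.comp hκ.tendsto_atTop) hz'
  · -- a proper point of `Z(τ)` lies in the limit set
    rw [hlim z]
    simp_rw [hRsupp]
    exact fun N ↦ mem_closure_iUnion_inter_iInter_translate Φ hY hD hrk hz hdim (hσ0.comp hκ.tendsto_atTop) N
  · obtain ⟨m, hm⟩ := hScl.exists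
    rw [← hm, hRcl]

/-! ### §2 Consequences: one proper point forces a non-zero class; locally proper regions -/

/-- **ONE PROPER POINT FORCES `[Y] ∧ [D₀] ∧ ⋯ ∧ [D_{k−1}] ≠ 0`**: if some `z ∈ Z(τ) = Y ∩ ⋂_j (D_j − τ_j)` is
proper (all regular points of `Z(τ)` near `z` have codimension `≥ g − (r + 1)`, `r + 1 = dim Y − k`), then the
intersection class is non-zero — `z` lies on the effective cycle `R ≠ 0` of §1, whose degree is positive.
(File 8 §6 is the case of a globally proper `Z(τ)`.) [cite: Fulton1998, §7.1 Prop. 7.1 (a) and §12.2 Thm. 12.2 (a)]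
[cite: Chirka1989, §16.1 Prop. 1] -/
theorem wedge_wedgeFamily_ne_zero_of_proper_point {q : ℕ}
    (hq : 2 * q + 2 * 1 = n) (k : ℕ) {d p r : ℕ} (hk : 2 * d + 2 * p = n) (hr : r + 1 + k = d)
    {Y : Set (ComplexTorus Φ)} (hY : HasPureDim 𝓘(ℂ, E) Y d)
    {D : Fin k → Set (ComplexTorus Φ)} (hD : ∀ j, HasPureDim 𝓘(ℂ, E) (D j) q) (τ : Fin k → ComplexTorus Φ)
    {z : ComplexTorus Φ} (hz : z ∈ Y ∩ ⋂ j, (fun x ↦ x + τ j) ⁻¹' D j)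
    (hdim : ∀ᶠ x in 𝓝 z, x ∈ Y ∩ ⋂ j, (fun x ↦ x + τ j) ⁻¹' D j →
      ∀ q', IsRegularPointOfCodim 𝓘(ℂ, E) (Y ∩ ⋂ j, (fun x ↦ x + τ j) ⁻¹' D j) q' x →
        finrank ℂ E ≤ q' + (r + 1)) :
    (analyticCycleClass Φ e hk hY).wedge (wedgeFamily k fun j ↦ analyticCycleClass Φ e hq (hD j)) ≠ 0 := by
  classical
  obtain ⟨R, hR0, -, -, hmem, hRcl⟩ :=
    exists_effectiveCycle_smul_wedge_wedgeFamily_eq_chainCycleClass_forall_mem_support Φ e hq k hk (p' := p + k)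
      rfl hr hY hD τ
  have hzR := hmem z hz hdim
  intro h0
  rw [h0, domDomCongr_finCongr_zero, smul_zero] at hRcl
  have hRne : R ≠ 0 := fun hR ↦ by
    rw [hR, HolomorphicChain.support_zero] at hzR
    exact hzR
  have hdeg := re_poincarePairing_kaehlerPow_chainCycleClass_pos Φ e (by omega : 2 * (r + 1) + 2 * (p + k) = n)
    R hR0 hRne
  rw [← hRcl, map_zero, Complex.zero_re] at hdeg
  exact lt_irrefl _ hdeg

omit [DecidableEq ι] [MeasurableSpace E] [BorelSpace E] in
/-- On an open `V` where `Z(τ)` coincides with a pure `(r+1)`-dimensional analytic `W`, every point of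
`Z(τ) ∩ V` is proper. [cite: Chirka1989, §12.1, p. 136] -/
private theorem eventually_finrank_le_of_inter_eq_inter {k r : ℕ} {Y : Set (ComplexTorus Φ)}
    {D : Fin k → Set (ComplexTorus Φ)} {τ : Fin k → ComplexTorus Φ} {V W : Set (ComplexTorus Φ)}
    (hV : IsOpen V) (hW : HasPureDim 𝓘(ℂ, E) W (r + 1))
    (hZW : (Y ∩ ⋂ j, (fun x ↦ x + τ j) ⁻¹' D j) ∩ V = W ∩ V) {z : ComplexTorus Φ} (hzV : z ∈ V) :
    ∀ᶠ x in 𝓝 z, x ∈ Y ∩ ⋂ j, (fun x ↦ x + τ j) ⁻¹' D j →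
      ∀ q', IsRegularPointOfCodim 𝓘(ℂ, E) (Y ∩ ⋂ j, (fun x ↦ x + τ j) ⁻¹' D j) q' x →
        finrank ℂ E ≤ q' + (r + 1) := by
  obtain ⟨c, hc, -, -, hreg⟩ := hW
  filter_upwards [hV.mem_nhds hzV] with x hxV hxZ q' hq'
  have hxW : x ∈ W := (hZW.subset ⟨hxZ, hxV⟩).1
  have hq'W : IsRegularPointOfCodim 𝓘(ℂ, E) W q' x := hq'.congr_set hV hxV hZW
  have h := (hreg x ⟨hxW, q', hq'W⟩).codim_unique hxW hq'W
  omega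

/-- **A LOCALLY PROPER REGION LIES ON THE FULTON CYCLE.** If on an open `V ⊆ X` the intersection
`Z(τ) = Y ∩ ⋂_j (D_j − τ_j)` coincides with a closed analytic `W` of the expected pure dimension `r + 1`
(`Z(τ) ∩ V = W ∩ V`), then the effective cycle `R` of §1 (`|R| ⊆ Z(τ)`, `class = cl(R)`) satisfies
`Z(τ) ∩ V ⊆ |R|`. [cite: Fulton1998, §7.1 Prop. 7.1 (a) and §12.2 Thm. 12.2 (a)] [cite: Chirka1989, §16.1 Prop. 1] -/
theorem exists_effectiveCycle_inter_subset_support_of_inter_eq_inter {q : ℕ}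
    (hq : 2 * q + 2 * 1 = n) (k : ℕ) {d p p' r : ℕ} (hk : 2 * d + 2 * p = n) (hp' : p + k = p')
    (hr : r + 1 + k = d) {Y : Set (ComplexTorus Φ)} (hY : HasPureDim 𝓘(ℂ, E) Y d)
    {D : Fin k → Set (ComplexTorus Φ)} (hD : ∀ j, HasPureDim 𝓘(ℂ, E) (D j) q) (τ : Fin k → ComplexTorus Φ)
    {V W : Set (ComplexTorus Φ)} (hV : IsOpen V) (hW : HasPureDim 𝓘(ℂ, E) W (r + 1))
    (hZW : (Y ∩ ⋂ j, (fun x ↦ x + τ j) ⁻¹' D j) ∩ V = W ∩ V) :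
    ∃ R : HolomorphicChain 𝓘(ℂ, E) (ComplexTorus Φ) (r + 1), (∀ W', 0 ≤ R.mult W') ∧
      R.support ⊆ Y ∩ ⋂ j, (fun x ↦ x + τ j) ⁻¹' D j ∧
      (Y ∩ ⋂ j, (fun x ↦ x + τ j) ⁻¹' D j) ∩ V ⊆ R.support ∧
        (orientationSign Φ e : ℂ) ^ k •
            ((analyticCycleClass Φ e hk hY).wedge
                (wedgeFamily k fun j ↦ analyticCycleClass Φ e hq (hD j))).domDomCongr
              (finCongr (by omega : 2 * p + 2 * k = 2 * p')) =
          chainCycleClass Φ e (by omega : 2 * (r + 1) + 2 * p' = n) R := by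
  obtain ⟨R, hR0, hRs, -, hmem, hRcl⟩ :=
    exists_effectiveCycle_smul_wedge_wedgeFamily_eq_chainCycleClass_forall_mem_support Φ e hq k hk hp' hr hY hD τ
  exact ⟨R, hR0, hRs, fun z hz ↦ hmem z hz.1 (eventually_finrank_le_of_inter_eq_inter Φ hV hW hZW hz.2), hRcl⟩

/-- **A non-empty locally proper region forces `[Y] ∧ [D₀] ∧ ⋯ ∧ [D_{k−1}] ≠ 0`.**
[cite: Fulton1998, §7.1 Prop. 7.1 (a) and §12.2 Thm. 12.2 (a)] -/
theorem wedge_wedgeFamily_ne_zero_of_inter_eq_inter {q : ℕ}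
    (hq : 2 * q + 2 * 1 = n) (k : ℕ) {d p r : ℕ} (hk : 2 * d + 2 * p = n) (hr : r + 1 + k = d)
    {Y : Set (ComplexTorus Φ)} (hY : HasPureDim 𝓘(ℂ, E) Y d)
    {D : Fin k → Set (ComplexTorus Φ)} (hD : ∀ j, HasPureDim 𝓘(ℂ, E) (D j) q) (τ : Fin k → ComplexTorus Φ)
    {V W : Set (ComplexTorus Φ)} (hV : IsOpen V) (hW : HasPureDim 𝓘(ℂ, E) W (r + 1))
    (hZW : (Y ∩ ⋂ j, (fun x ↦ x + τ j) ⁻¹' D j) ∩ V = W ∩ V)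
    (hne : ((Y ∩ ⋂ j, (fun x ↦ x + τ j) ⁻¹' D j) ∩ V).Nonempty) :
    (analyticCycleClass Φ e hk hY).wedge (wedgeFamily k fun j ↦ analyticCycleClass Φ e hq (hD j)) ≠ 0 := by
  obtain ⟨z, hz, hzV⟩ := hne
  exact wedge_wedgeFamily_ne_zero_of_proper_point Φ e hq k hk hr hY hD τ hz
    (eventually_finrank_le_of_inter_eq_inter Φ hV hW hZW hzV)

end ComplexTorus

end Literature.Geometry.Kaehler

end
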